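import Mathlib.FieldTheory.PurelyInseparable.PerfectClosure
import Mathlib.FieldTheory.IsAlgClosed.AlgebraicClosure
import HarnessLib

/-!
# `Pialt` (crux stmt-ResolutionOfSingularities-0555), line `SketchIdeator2` / Card A:
# one finite purely inseparable extension containing finitely many given ones

Helper file (`--supports stmt-ResolutionOfSingularities-0555`; STUB-PLAN
`Cruxes/Pialt/STUB-PLAN-stub_radicialPatching.md`, helper H3 = gap (a) of the crux notes, "ONE `L`
for all (finitely many) `L_v`", in its trivial finite form).

* `exists_common_purelyInseparable_extension` — finitely many finite purely inseparable
  extensions `M₁, …, Mₙ` of a field `K` embed over `K` into ONE finite purely inseparable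
  extension `L` of `K`: inside an algebraic closure `E` of `K` take the compositum of the images
  (`⨆` of the `fieldRange`s of `IsAlgClosed.lift`), which is finite-dimensional
  (`IntermediateField.finiteDimensional_iSup_of_finite`) and purely inseparable (it lies in the
  relative perfect closure `perfectClosure K E`, Mathlib `le_perfectClosure_iff`).

Source: folklore (e.g. Stacks Project, Tag 09HE and Tag 030K: composita of purely inseparable
extensions are purely inseparable).
-/

set_option linter.dupNamespace false -- mandated namespace of this single-conjunct summit

noncomputable section

namespace Summit.ResolutionOfSingularities.ResolutionOfSingularities.Theorems.Pialt.RadiciallyRegular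

/-- **A common finite purely inseparable extension.** Finitely many finite purely inseparable
extensions `M i` (`i : Fin n`) of a field `K` all embed over `K` into one finite purely
inseparable extension `L` of `K` (the compositum of their images in an algebraic closure, which
lies in the relative perfect closure of `K`). [folklore] -/
theorem exists_common_purelyInseparable_extension (K : Type) [Field K] {n : ℕ}
    (M : Fin n → Type) [∀ i, Field (M i)] [∀ i, Algebra K (M i)]
    [∀ i, FiniteDimensional K (M i)] [∀ i, IsPurelyInseparable K (M i)] :
    ∃ (L : Type) (_ : Field L) (_ : Algebra K L), FiniteDimensional K L ∧
      IsPurelyInseparable K L ∧ ∀ i, Nonempty (M i →ₐ[K] L) := by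
  let E := AlgebraicClosure K
  -- embed every `M i` into `E`
  let φ : ∀ i, M i →ₐ[K] E := fun i => IsAlgClosed.lift
  -- the compositum of the images
  let L : IntermediateField K E := ⨆ i, (φ i).fieldRange
  haveI hfd : ∀ i, FiniteDimensional K (φ i).fieldRange := fun i =>
    LinearEquiv.finiteDimensional (φ i).equivFieldRange.toLinearEquiv
  haveI : FiniteDimensional K L := IntermediateField.finiteDimensional_iSup_of_finite
  have hpi : ∀ i, IsPurelyInseparable K (φ i).fieldRange := fun i =>
    AlgEquiv.isPurelyInseparable (φ i).equivFieldRange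
  have hL : L ≤ perfectClosure K E :=
    iSup_le fun i => (le_perfectClosure_iff (L := (φ i).fieldRange)).mpr (hpi i)
  haveI : IsPurelyInseparable K L := (le_perfectClosure_iff (L := L)).mp hL
  refine ⟨L, inferInstance, inferInstance, inferInstance, inferInstance, fun i => ⟨?_⟩⟩
  exact (IntermediateField.inclusion (le_iSup (fun i => (φ i).fieldRange) i)).comp
    (φ i).equivFieldRange.toAlgHom

end Summit.ResolutionOfSingularities.ResolutionOfSingularities.Theorems.Pialt.RadiciallyRegular

end
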